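import Summits.BirchSwinnertonDyer.BirchSwinnertonDyer.Theorems.CyclotomicUntwistGammaLeadingTerm
import Summits.BirchSwinnertonDyer.BirchSwinnertonDyer.Theorems.CyclotomicUntwistGammaUniqueness
import HarnessLib

/-!
# The two typed shapes of IMC₃ agree, and the one-stop rank-one transfer from D1's predicate
# (route `CyclotomicUntwist`, crux K1 `PSRankOneLowerHalfAtThree`)

Cell `pub/bsd-wall` (D-0145 line `route-BirchSwinnertonDyer-CyclotomicUntwist`), seat `bsd-line-cycu-p1`
(prover seat 1/3), helper toward crux K1 (stmt-BirchSwinnertonDyer-21580). THEOREMS ONLY (no definition,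
no named fact, no `sorry`). BSD is not proved by this file and no crux of the route is proved by it;
IMC₃ stays a HYPOTHESIS shape of D3.

* `isUnitMultipleOf_iff_isUnitMultipleOfAtCharacters` — for a datum `D : PSFiniteSlopeSelmerData W η α`
  and ADDITIVE ball values `𝓛`, D3's ideal-identity shape `D.IsUnitMultipleOf 𝓛` (`char = u ⋆ 𝓛`,
  `u ∈ 3^ℤ·Λ_𝓞^×`) and its character-value shape `D.IsUnitMultipleOfAtCharacters 𝓛`
  (`char(ξ) = u(ξ)·𝓛(ξ)` at every Dirichlet character of `3`-power level) are EQUIVALENT: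
  `⇒` is the multiplicativity `gammaCharValue_gammaConv` (p588643), `⇐` is Višik uniqueness
  `eq_of_forall_gammaCharValue_eq` (both sides are additive). So the "fallback form" of the definition
  request D3 is not weaker.
* `rankOne_transfer_of_isPSCyclotomicLFunctionOf` — the ONE-STOP value-level package for the rank-one
  reading: from `IsPSCyclotomicLFunctionOf W η α 𝓛` (D1), `D.IsNormalisedFor 𝓛` (typed IMC₃),
  `D.HasExactOrderAtOne` and `D.selmerRank = 1`: `𝓛(𝟙) = c₀ = 0`, `c₁ = 𝓛′(𝟙) ≠ 0`, `D.orderAtOne = 1`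
  and `‖D.leadingCoeffAtOne‖ = 3^{-e}·‖c₁‖`, `e = D.pPowerShift` (SHIFT, p589155).

References: [cite: Benois2014, §0.4 (ii) and Remark 1] · [cite: Bellaiche2021, Thm. 6.2.13 (i) and §6.3.5]
· [cite: PerrinRiou1993AIF, Introduction].
-/

noncomputable section

open Filter Topology Finset
open Literature.NumberTheory.EllipticCurves Literature.NumberTheory.IwasawaTheory
open Summit.BirchSwinnertonDyer.BirchSwinnertonDyer.Theorems.PSGammaConvolution
open Summit.BirchSwinnertonDyer.BirchSwinnertonDyer.Theorems.PSGammaLeadingTerm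
open Summit.BirchSwinnertonDyer.BirchSwinnertonDyer.Theorems.PSGammaUniqueness

-- single-conjunct summit: `Summit.BirchSwinnertonDyer.BirchSwinnertonDyer.…` repeats the name by design
set_option linter.dupNamespace false

namespace Summit.BirchSwinnertonDyer.BirchSwinnertonDyer.Theorems.PSGammaIMCShapes

variable {p : ℕ} [Fact p.Prime]

/-- An element of `p^ℤ · Λ_𝓞^×` is additive (it is `p^e · v` with `v ∈ Λ_𝓞^×` additive).
[cite: Benois2014, §0.4 Remark 1] -/
theorem isGammaDistribution_of_isIwasawaUnitUpToPPower {u : (n : ℕ) → ZMod (p ^ n) → ℂ_[p]}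
    (hu : IsIwasawaUnitUpToPPower p u) : IsGammaDistribution p u := by
  obtain ⟨e, v, hv, huv⟩ := hu
  have : u = fun n s ↦ (p : ℂ_[p]) ^ e * v n s := funext fun n ↦ funext fun s ↦ huv n s
  rw [this]
  exact hv.1.smul _

section Three

variable {W : WeierstrassCurve ℚ} {η : DirichletCharacter ℂ_[3] (3 ^ 2)} {α : ℂ_[3]}
  (D : PSFiniteSlopeSelmerData W η α) {𝓛 : (n : ℕ) → ZMod (3 ^ n) → ℂ_[3]}

/-- `char = u ⋆ 𝓛` ⇒ `char(ξ) = u(ξ)·𝓛(ξ)` at every character (multiplicativity of character values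
under convolution). [cite: Benois2014, §0.4 (ii)] [cite: Bellaiche2021, §6.3.5] -/
theorem isUnitMultipleOfAtCharacters_of_isUnitMultipleOf (h : D.IsUnitMultipleOf 𝓛) :
    D.IsUnitMultipleOfAtCharacters 𝓛 := by
  obtain ⟨u, hu, hchar⟩ := h
  exact ⟨u, hu, fun m ξ ↦ by rw [hchar, gammaCharValue_gammaConv]⟩

/-- `char(ξ) = u(ξ)·𝓛(ξ)` at every character ⇒ `char = u ⋆ 𝓛`, for ADDITIVE `𝓛` (Višik uniqueness:
both sides are additive with the same character values). [cite: Bellaiche2021, Thm. 6.2.13 (i)] [cite: Benois2014, §0.4 (ii)] -/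
theorem isUnitMultipleOf_of_isUnitMultipleOfAtCharacters (h : D.IsUnitMultipleOfAtCharacters 𝓛)
    (h𝓛 : IsGammaDistribution 3 𝓛) : D.IsUnitMultipleOf 𝓛 := by
  obtain ⟨u, hu, hval⟩ := h
  refine ⟨u, hu, eq_of_forall_gammaCharValue_eq D.isGammaDistribution_charElt
    (isGammaDistribution_gammaConv (isGammaDistribution_of_isIwasawaUnitUpToPPower hu) h𝓛)
    fun m ξ _ _ _ ↦ ?_⟩
  rw [hval m ξ, gammaCharValue_gammaConv]

/-- **The two typed shapes of IMC₃ are equivalent** for additive `𝓛` (in particular for every `𝓛` with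
`IsPSCyclotomicLFunctionOf W η α 𝓛`). [cite: Benois2014, §0.4 (ii) and Remark 1] [cite: Bellaiche2021, Thm. 6.2.13 (i)] -/
theorem isUnitMultipleOf_iff_isUnitMultipleOfAtCharacters (h𝓛 : IsGammaDistribution 3 𝓛) :
    D.IsUnitMultipleOf 𝓛 ↔ D.IsUnitMultipleOfAtCharacters 𝓛 :=
  ⟨isUnitMultipleOfAtCharacters_of_isUnitMultipleOf D,
    fun h ↦ isUnitMultipleOf_of_isUnitMultipleOfAtCharacters D h h𝓛⟩

/-- **One-stop rank-one transfer from D1's predicate.** For `𝓛` THE principal-series cyclotomic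
`3`-adic `L`-function of `(W, η, α)` (`IsPSCyclotomicLFunctionOf`), a datum `D` normalised for `𝓛`
(typed IMC₃) whose characteristic element vanishes at `𝟙` to order exactly `selmerRank = 1`:
`𝓛(𝟙) = c₀ = 0`, `𝓛′(𝟙) = c₁ ≠ 0`, `D.orderAtOne = 1`, and `‖D.leadingCoeffAtOne‖ = 3^{-e}·‖c₁‖` with
`e = D.pPowerShift`. These are the value-level inputs of the reading GZ₃ ∧ IMC₃ ∧ READ of crux K1.
[cite: Benois2014, §0.4 (ii) and Remark 1; §4.2 Prop. 12] [cite: PerrinRiou1993AIF, Introduction] -/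
theorem rankOne_transfer_of_isPSCyclotomicLFunctionOf (h𝓛 : IsPSCyclotomicLFunctionOf W η α 𝓛)
    (h : D.IsNormalisedFor 𝓛) (hex : D.HasExactOrderAtOne) (hr : D.selmerRank = 1) :
    gammaMahlerCoeff 3 𝓛 0 = 0 ∧ gammaMahlerCoeff 3 𝓛 1 ≠ 0 ∧ D.orderAtOne = 1 ∧
      ‖D.leadingCoeffAtOne‖ = (3 : ℝ) ^ (-D.pPowerShift) * ‖gammaMahlerCoeff 3 𝓛 1‖ := by
  obtain ⟨hadd, hgr⟩ := h𝓛.isGammaDistribution_and_hasGrowthOrder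
  obtain ⟨h0, h1, hlead⟩ := mahlerCoeff_shape_of_isNormalisedFor_of_hasExactOrderAtOne_one D h hadd hgr hex hr
  refine ⟨h0, h1, ?_, ?_⟩
  · rw [hex, hr, Nat.cast_one]
  · rw [norm_leadingCoeffAtOne_of_isNormalisedFor D h hadd hgr, hlead]

end Three

end Summit.BirchSwinnertonDyer.BirchSwinnertonDyer.Theorems.PSGammaIMCShapes

end
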